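import Summits.ResolutionOfSingularities.ResolutionOfSingularities.Theorems.FrobeniusLadderFInjectiveMacaulayficationSigma5P2d5CNewtonKFanTables
import Summits.ResolutionOfSingularities.ResolutionOfSingularities.Theorems.FrobeniusLadderFInjectiveMacaulayficationFanCheckChunks
import HarnessLib

/-!
# KERNEL CHECKS (fan side) of the class-route cover data for P2d5C shifted, f′ = σ₅(f_P2d5C) = z² + x⁴z + x⁹ + x¹⁰ + y³ + u³ + t³ + s³ (f_P2d5C = z² + x⁴z + y³ + u³ + t³ + s³ = the (5,2) census bed of row (5,2) #1, σ₅ : z ↦ z + x⁵, char 2; six variables (x,y,u,t,s,z) = X0..X5): shapes, (hgen), unimodularity, vertex bridge, pure powers, (hAJ), the vertex property (hge),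
# the local-matrix bridge `hVq` and the NEWTON MINIMISER check — each ONE `decide +kernel` on the tables of `Sigma5P2d5CNewtonKFanTables`
# (crux `FInjectiveMacaulayfication` stmt-ResolutionOfSingularities-15315, chain w45a; (W-WND) class-route coverage programme, res-L1-w45a-plan-1 RULING R22.14 (2); seat res-L1-w45a-stub-2 g11)

Support file for crux stmt-ResolutionOfSingularities-15315 (`FrobeniusLadder.FInjectiveMacaulayfication`), chain w45a.
[OURS · L1 W4.5a] — NOT a statement of any manuscript; AI-written, weaker than expert review.

The Boolean checks of res-L1-w45a-stub-4's `FanCheckKit` (+ res-L1-w45a-stub-2's `FanCheckMulti` / `FanCheckChunks`) on the class-route data of P2d5C shifted, f′ = σ₅(f_P2d5C) = z² + x⁴z + x⁹ + x¹⁰ + y³ + u³ + t³ + s³ (f_P2d5C = z² + x⁴z + y³ + u³ + t³ + s³ = the (5,2) census bed of row (5,2) #1, σ₅ : z ↦ z + x⁵, char 2; six variables (x,y,u,t,s,z) = X0..X5) (`z^2+x^4*z+x^9+x^10+y^3+u^3+t^3+s^3`, char 2;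
the `Σ_f ∧ Σ(𝔪)` fan `P2d5Cs5_fan.json` 6b5f45df4b7341cc, 71 charts, centre `𝔪·K` with `|K| = 245`, 1470 generators; certificate `P2d5Cs5_cover.json` sha16 bb735479b82e1976): `checkShapes` (no exceptional
vectors, `r = 0`), `CL.length = 71`, `checkHgen`, `checkDetUnit`, `FanCheckMulti.checkMVBridge`, `checkHprim`, `checkHAJ`, the length check of `KL2`, the vertex property `checkHge`
(one pass), the bridge `Vq c = chartV 6 RAYS CL 71 c`, and the NEWTON MINIMISER check (`U0 c ∈ SUPPv` minimises every row functional of `Vq c` over `SUPPv` — the fan refines `Σ_f`).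
The cover records are checked in `Sigma5P2d5CNewtonKCoverChecks`; the binders are `Sigma5P2d5CNewtonKFan`. No definitions, no named facts. [folklore; cite: CoxLittleSchenck2011, §2.3]
-/

-- single-problem summit: the doubled namespace component is forced
set_option linter.dupNamespace false

namespace Summit.ResolutionOfSingularities.ResolutionOfSingularities.Theorems.FInjectiveMacaulayfication.Sigma5P2d5CNewtonKFan

open Summit.ResolutionOfSingularities.ResolutionOfSingularities.Theorems.FInjectiveMacaulayfication
open FanCheckKit FanCheckSound

/-! ## Light checks (ONE `decide` each; bundled with `CL.length = 71`, which keeps every statement distinct from the sibling fan modules) -/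

/-- (tlen, shapes, lengths of `K`'s table): light fan-side checks I. -/
theorem fan_checks_a : CL.length = 71 ∧ checkShapes 6 0 AL2 RAYS CL = true ∧ (KL2.all fun ch => allLen 6 ch) = true := by
  decide +kernel

/-- (tlen, hgen, hV, vertex bridge): light fan-side checks II. -/
theorem fan_checks_b : CL.length = 71 ∧ checkHgen 6 AL2 RAYS CL = true ∧ checkDetUnit 6 RAYS CL VinvTL = true ∧
    FanCheckMulti.checkMVBridge 6 AL2 MV2 50 71 CL = true := by
  decide +kernel

/-- (tlen, hprim, hAJ): light fan-side checks III. -/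
theorem fan_checks_c : CL.length = 71 ∧ checkHprim 6 AL2 PJ = true ∧ checkHAJ AL2 = true := by
  decide +kernel

/-- 71 charts. -/
theorem tlen : CL.length = 71 := fan_checks_a.1

/-- (shapes) lengths and index bounds of all tables. -/
theorem shapes : checkShapes 6 0 AL2 RAYS CL = true ∧ CL.length = 71 := ⟨fan_checks_a.2.1, tlen⟩

/-- (hgen) `V c · a c i = V c · m c + e_i`. -/
theorem check_hgen : checkHgen 6 AL2 RAYS CL = true ∧ CL.length = 71 := ⟨fan_checks_b.2.1, tlen⟩

/-- (hV) `V c · W c = 1` over `ℤ`. -/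
theorem check_det : checkDetUnit 6 RAYS CL VinvTL = true ∧ CL.length = 71 := ⟨fan_checks_b.2.2.1, tlen⟩

/-- The vertex table `MV2` agrees with the chart records. -/
theorem check_mvbridge : FanCheckMulti.checkMVBridge 6 AL2 MV2 50 71 CL = true := fan_checks_b.2.2.2

/-- (hprim) pure powers of all five variables among the generators. -/
theorem check_hprim : checkHprim 6 AL2 PJ = true ∧ CL.length = 71 := ⟨fan_checks_c.2.1, tlen⟩

/-- (hAJ) no generator is `0`. -/
theorem check_hAJ : checkHAJ AL2 = true ∧ CL.length = 71 := ⟨fan_checks_c.2.2, tlen⟩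

/-- Every chunk of `K`'s table consists of vectors of length 5. -/
theorem check_klen : (KL2.all fun ch => allLen 6 ch) = true ∧ CL.length = 71 := ⟨fan_checks_a.2.2, tlen⟩

/-! ## (hge) the vertex property, one pass (1470 generators × 17 rays) -/

/-- ★ (hge) the vertex property on all 17 rays (with the specimen-distinct conjunct `CL.length = 71`). -/
theorem check_hge : checkHge AL2 RAYS CL = true ∧ CL.length = 71 := ⟨by decide +kernel, tlen⟩

/-! ## The Newton side: local matrices and minimisers -/

/-- The local matrix table agrees with `chartV 6 RAYS CL 71`. -/
theorem hVq : ∀ c : Fin 71, Vq c = chartV 6 RAYS CL 71 c := by decide +kernel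

/-- Every Newton minimiser is a support vector of the bed. -/
theorem hU0_mem : ∀ c : Fin 71, U0 c ∈ SUPPv := by decide +kernel

/-- ★ THE NEWTON MINIMISER CHECK (the fan refines `Σ_f`): on every chart, `U0 c` minimises every row functional of `Vq c` over the support of the bed (explicit dot products). -/
theorem hmin_raw : ∀ c : Fin 71, ∀ i : Fin 6, ∀ u ∈ SUPPv,
    Vq c i 0 * U0 c 0 + Vq c i 1 * U0 c 1 + Vq c i 2 * U0 c 2 + Vq c i 3 * U0 c 3 + Vq c i 4 * U0 c 4 + Vq c i 5 * U0 c 5 ≤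
      Vq c i 0 * u 0 + Vq c i 1 * u 1 + Vq c i 2 * u 2 + Vq c i 3 * u 3 + Vq c i 4 * u 4 + Vq c i 5 * u 5 := by
  decide +kernel

/-- The pure powers `x_j^(N_j)` in `K`, as a membership check on the flattened table — so `𝔪 ⊆ √K`. -/
theorem hKpow : (Pi.single 0 110 : Fin 6 → ℕ) ∈ KL2.flatten.map (vecOf 6) ∧ (Pi.single 1 41 : Fin 6 → ℕ) ∈ KL2.flatten.map (vecOf 6) ∧ (Pi.single 2 41 : Fin 6 → ℕ) ∈ KL2.flatten.map (vecOf 6) ∧ (Pi.single 3 41 : Fin 6 → ℕ) ∈ KL2.flatten.map (vecOf 6) ∧ (Pi.single 4 41 : Fin 6 → ℕ) ∈ KL2.flatten.map (vecOf 6) ∧ (Pi.single 5 26 : Fin 6 → ℕ) ∈ KL2.flatten.map (vecOf 6) ∧ CL.length = 71 := by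
  refine ⟨?_, ?_, ?_, ?_, ?_, ?_, tlen⟩ <;> decide +kernel

end Summit.ResolutionOfSingularities.ResolutionOfSingularities.Theorems.FInjectiveMacaulayfication.Sigma5P2d5CNewtonKFan
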